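import Summits.KontsevichZagierPeriods.KontsevichZagierPeriods.Theses.UnfoldedStokes
import Summits.KontsevichZagierPeriods.KontsevichZagierPeriods.Theorems.UnfoldedStokesUnfoldedStokesSquare
import Literature.NumberTheory.Transcendental.KZKernelConjectureForms
import Literature.NumberTheory.Transcendental.KZCubicalCalculus

/-!
# `StokesGeneration` (stmt-KontsevichZagierPeriods-3586) — calibration: the crux IS the summit

cdisprove (refuter) calibration / negative lemmas for the crux `StokesGeneration` of route
`KontsevichZagierPeriods/UnfoldedStokes` (`ker eval ≤ relations ⊔ closure S`, `S` the unfolded-Stokes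
square relators of thesis part A).

Since part A is LANDED (`unfoldedStokesSquare_proof`, stmt-3520: `S ⊆ relations`), the summand
`closure S` is redundant and the crux is, on the nose, the kernel conjecture `KZKernelConjecture`
(`stokesGeneration_iff_kernel`), hence — by the tree's `kzKernelConjecture_iff_isRational` — the SUMMIT
statement `KontsevichZagierPeriods` (`stokesGeneration_iff_summit`). Consequences recorded for the
planner and the line lead:

* a refutation of the crux is a refutation of the formalised Kontsevich–Zagier period conjecture and
  conversely (`not_stokesGeneration_iff_not_summit`); the GPC-strength barriers
  `kzConjecture_implies_*` apply to the crux verbatim;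
* `stokesGeneration_false_without_evalZero`: the hypothesis `eval x = 0` is load-bearing — the target
  subgroup `relations ⊔ closure S` is proper (`[pt, 1]` is not generated), i.e. the calculus is
  consistent;
* `saturated_of_stokesGeneration`: the crux forces `relations` to be a pure subgroup of the free
  group `FormalRep` (a torsion class of `FormalRep ⧸ relations` would refute it; none is known).

[Kontsevich–Zagier 2001, §1.2, Conjecture 1; Huber–Müller-Stach 2017, Conj. 13.2.1]
-/

noncomputable section

namespace Summit.KontsevichZagierPeriods.UnfoldedStokes.StokesGenerationNegative

open MeasureTheory Set
open Literature.NumberTheory.Transcendental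
open Literature.NumberTheory.Transcendental.KZ
open Literature.ModelTheory.ExponentialFields (IsSemialgebraic)
open Summit.KontsevichZagierPeriods.KontsevichZagierPeriods.Theses.UnfoldedStokes
  (StokesGeneration UnfoldedStokesSquare)

/-- **CALIBRATION 1.** The crux is the kernel conjecture `ker eval ≤ relations` on the nose: every
square relator is already a relation by the landed part A (`unfoldedStokesSquare_proof`).
[cite: KontsevichZagier2001, §1.2 Conjecture 1] -/
theorem stokesGeneration_iff_kernel : StokesGeneration ↔ KZKernelConjecture := by
  constructor
  · intro h x hx
    have hmem := h x hx
    have hsub : ∀ (A B : AddSubgroup FormalRep), B ≤ A → ∀ y, y ∈ A ⊔ B → y ∈ A :=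
      fun A B hle y hy => (sup_le le_rfl hle) hy
    refine hsub _ _ ((AddSubgroup.closure_le _).mpr ?_) _ hmem
    rintro d ⟨U, a, b, c, e, rB, rR, rT, rL, rW, rD, hUo, hUI, hUs, ha, hb, hc, he, hcl, sa, sb, sc,
      se, sa0, sa1, sb1, sc1, se0, hBd, hBi, hRd, hRi, hTd, hTi, hLd, hLi, hWd, hWi, hDd, hDi, rfl⟩
    exact Summit.KontsevichZagierPeriods.UnfoldedStokes.UnfoldedStokesSquare.unfoldedStokesSquare_proof
      U a b c e hUo hUI hUs ha hb hc he hcl sa sb sc se sa0 sa1 sb1 sc1 se0 rB rR rT rL rW rD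
      hBd hBi hRd hRi hTd hTi hLd hLi hWd hWi hDd hDi
  · intro h x hx
    exact AddSubgroup.mem_sup_left (h x hx)

/-- **CALIBRATION 2.** The crux is equivalent to the SUMMIT statement `KontsevichZagierPeriods`
(Kontsevich–Zagier's Conjecture 1 over the fixed calculus of `KZCalculus.lean`).
[cite: KontsevichZagier2001, §1.2 Conjecture 1] -/
theorem stokesGeneration_iff_summit : StokesGeneration ↔ _root_.KontsevichZagierPeriods :=
  stokesGeneration_iff_kernel.trans
    (kzKernelConjecture_iff_isRational.trans KontsevichZagierPeriods_iff.symm)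

/-- The negative reading: refuting the crux is refuting the summit, and conversely.
[cite: KontsevichZagier2001, §1.2 Conjecture 1] -/
theorem not_stokesGeneration_iff_not_summit : ¬ StokesGeneration ↔ ¬ _root_.KontsevichZagierPeriods :=
  not_congr stokesGeneration_iff_summit

/-- **`eval x = 0` is load-bearing** (the crux WITHOUT its hypothesis is false; equivalently the
target subgroup is proper, the calculus consistent): the point representation `[pt, 1]` does not lie
in `relations ⊔ closure S`, by `S ⊆ relations` and soundness `relations ≤ ker eval`. The set `S` is
the crux's, verbatim. [cite: KontsevichZagier2001, §1.2] -/
theorem stokesGeneration_false_without_evalZero :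
    ¬ (∀ x : FormalRep, x ∈ relations ⊔
        AddSubgroup.closure {d : FormalRep | ∃ (U : Set (Fin 2 → ℝ)) (a b c e : (Fin 2 → ℝ) → ℝ)
      (rB rR rT rL rW : IntegralRep 2) (rD : IntegralRep 3),
      (IsOpen U) ∧ (Set.Icc (0 : Fin 2 → ℝ) 1 ⊆ U) ∧ (∀ p ∈ U, ∀ u ∈ Set.Icc (0 : ℝ) 1, u • p ∈ U) ∧
      (ContDiffOn ℝ 1 a U) ∧ (ContDiffOn ℝ 1 b U) ∧ (ContDiffOn ℝ 1 c U) ∧ (ContDiffOn ℝ 1 e U) ∧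
      (∀ p ∈ U, fderiv ℝ a p (Pi.single 1 1) = fderiv ℝ b p (Pi.single 0 1)) ∧
      (IsSemialgebraicFunOn ℚ U a) ∧ (IsSemialgebraicFunOn ℚ U b) ∧ (IsSemialgebraicFunOn ℚ U c) ∧
      (IsSemialgebraicFunOn ℚ U e) ∧
      (IsSemialgebraicFunOn ℚ U (fun p => fderiv ℝ a p (Pi.single 0 1))) ∧
      (IsSemialgebraicFunOn ℚ U (fun p => fderiv ℝ a p (Pi.single 1 1))) ∧
      (IsSemialgebraicFunOn ℚ U (fun p => fderiv ℝ b p (Pi.single 1 1))) ∧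
      (IsSemialgebraicFunOn ℚ U (fun p => fderiv ℝ c p (Pi.single 1 1))) ∧
      (IsSemialgebraicFunOn ℚ U (fun p => fderiv ℝ e p (Pi.single 0 1))) ∧
      (rB.domain = {x | ∀ i, x i ∈ Set.Ioo (0 : ℝ) 1}) ∧
      (Set.EqOn rB.integrand (fun x => x 0 * a ![x 1 * x 0, 0] * c ![x 0, 0]) rB.domain) ∧
      (rR.domain = {x | ∀ i, x i ∈ Set.Ioo (0 : ℝ) 1}) ∧
      (Set.EqOn rR.integrand (fun x => (a ![x 1, x 1 * x 0] + x 0 * b ![x 1, x 1 * x 0]) * e ![1, x 0])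
        rR.domain) ∧
      (rT.domain = {x | ∀ i, x i ∈ Set.Ioo (0 : ℝ) 1}) ∧
      (Set.EqOn rT.integrand (fun x => (x 0 * a ![x 1 * x 0, x 1] + b ![x 1 * x 0, x 1]) * c ![x 0, 1])
        rT.domain) ∧
      (rL.domain = {x | ∀ i, x i ∈ Set.Ioo (0 : ℝ) 1}) ∧
      (Set.EqOn rL.integrand (fun x => x 0 * b ![0, x 1 * x 0] * e ![0, x 0]) rL.domain) ∧
      (rW.domain = {x | ∀ i, x i ∈ Set.Ioo (0 : ℝ) 1}) ∧
      (Set.EqOn rW.integrand (fun x => a ![x 0, x 1] * e ![x 0, x 1] - b ![x 0, x 1] * c ![x 0, x 1])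
        rW.domain) ∧
      (rD.domain = {x | ∀ i, x i ∈ Set.Ioo (0 : ℝ) 1}) ∧
      (Set.EqOn rD.integrand (fun x => (x 0 * a ![x 2 * x 0, x 2 * x 1] + x 1 * b ![x 2 * x 0, x 2 * x 1]) *
        (fderiv ℝ e ![x 0, x 1] (Pi.single 0 1) - fderiv ℝ c ![x 0, x 1] (Pi.single 1 1))) rD.domain) ∧
      d = of rB + of rR - of rT - of rL - of rW - of rD}) := by
  intro h
  -- the point representation `[pt, 1]` of value `1`
  set r₀ : IntegralRep 0 := IntegralRep.tameCube (fun _ => (1 : ℝ)) (fun _ _ => analyticAt_const)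
    ((isSemialgebraicFunOn_natCast isSemialgebraic_cube 1).congr fun _ _ => by simp) with hr₀
  have hval : r₀.value = 1 := by simp [hr₀, IntegralRep.value, IntegralRep.tameCube, -cube_zero]
  -- the right-hand side is `relations` (part A) and `relations ≤ ker eval` (soundness)
  have hsub : ∀ (A B : AddSubgroup FormalRep), B ≤ A → ∀ y, y ∈ A ⊔ B → y ∈ A :=
    fun A B hle y hy => (sup_le le_rfl hle) hy
  have hmem : of r₀ ∈ relations := by
    refine hsub _ _ ((AddSubgroup.closure_le _).mpr ?_) _ (h (of r₀))
    rintro d ⟨U, a, b, c, e, rB, rR, rT, rL, rW, rD, hUo, hUI, hUs, ha, hb, hc, he, hcl, sa, sb, sc,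
      se, sa0, sa1, sb1, sc1, se0, hBd, hBi, hRd, hRi, hTd, hTi, hLd, hLi, hWd, hWi, hDd, hDi, rfl⟩
    exact Summit.KontsevichZagierPeriods.UnfoldedStokes.UnfoldedStokesSquare.unfoldedStokesSquare_proof
      U a b c e hUo hUI hUs ha hb hc he hcl sa sb sc se sa0 sa1 sb1 sc1 se0 rB rR rT rL rW rD
      hBd hBi hRd hRi hTd hTi hLd hLi hWd hWi hDd hDi
  have h0 := relations_le_ker_eval_holds hmem
  rw [AddMonoidHom.mem_ker, eval_of, hval] at h0
  exact one_ne_zero h0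

/-- **Saturation (attack handle).** The crux forces `relations` to be PURE in the free abelian group
`FormalRep`: if a non-zero multiple of `x` is a relation then so is `x` (because `ℝ` is torsion-free
and the crux is the kernel conjecture). Contrapositive: a torsion class of `FormalRep ⧸ relations`
refutes the crux. [cite: KontsevichZagier2001, §1.2] -/
theorem saturated_of_stokesGeneration (h : StokesGeneration) {x : FormalRep} {k : ℤ} (hk : k ≠ 0)
    (hx : k • x ∈ relations) : x ∈ relations := by
  have h0 : eval (k • x) = 0 := relations_le_ker_eval_holds hx
  rw [map_zsmul, smul_eq_zero] at h0
  exact (stokesGeneration_iff_kernel.mp h) x (h0.resolve_left hk)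

end Summit.KontsevichZagierPeriods.UnfoldedStokes.StokesGenerationNegative
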